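import Mathlib
import Summits.Ventures.PercRepro2.Defs
import Summits.Ventures.PercRepro2.Independence
import Summits.Ventures.PercRepro2.Harris
import Summits.Ventures.PercRepro2.Graph
import Summits.Ventures.PercRepro2.Exploration
import Summits.Ventures.PercRepro2.RedFavour
import Summits.Ventures.PercRepro2.RedFavourCluster

/-!
# RED-FAVOUR on a family of explored blue clusters: the all-red-only slice for any set `S`
(blind cell PercRepro2, p2 g12; paper proofs/P2-G12-NONFULL.md §3–§4)

`RedFavourCluster.lean` explores ONE blue cluster.  Here the blue clusters of all the vertices of
a finite set `S` are explored at once (`blueFamilyEvent`: «the blue cluster of `v` is `fam v`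
for every `v ∈ S`»), which freezes the whole partition of `S` by mark-free blue clusters.  Hence:

* `prob_blueFamily_blue_red_le_prob_blueFamily_red_blue` — for a family with `p ∉ fam v` on `S`
  and any increasing event `I`: P(family, `p ~_b q`, `p ≁_r q`, `I`) ≤ P(family, `p ~_r q`,
  `p ≁_b q`, `I`);
* `prob_family_blue_red_le_prob_family_red_blue` — summed over the families: for ANY predicate
  `Φ` on the family of blue clusters of the vertices of `S` (`famOf`), with `S` blue-disjoint from
  `p, q` (`notBlueJoinedAll`) and any increasing `I` (e.g. `redJoined S`: `S` red-joined):
  P(Φ, `S ∩ C = ∅`, `p ~_b q`, `p ≁_r q`, `I`) ≤ P(Φ, `S ∩ C = ∅`, `p ~_r q`, `p ≁_b q`, `I`).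

With `I = redJoined ends p q S` and `Φ` = «the partition of `S` by the blue clusters lies in an
up-set 𝒰» this is the ALL-RED-ONLY SLICE of the non-full partition domination of the m9 lane for
every `S` (the case `S ⊆ D ∖ C`); for `S = {x, y}` and `Φ` = «`x, y` in one cluster» it is (NF2).
-/

namespace Summit.Ventures.PercRepro2

namespace RedFavour

section Family

variable {V : Type*} {E : Type*}

/-- A path from `p` that cannot reach a set `U` never uses an edge touching `U`: if `p ↔ q` in
`ω`, then `p ↔ q` in `ω` with every edge touching `U` closed. -/
lemma conn_restrict_of_not_conn {ends : E → Sym2 V} {ω : Config E} {p q : V} {U : Set V}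
    (hU : ∀ z ∈ U, ¬ Conn ends ω p z) (G : Set E) [DecidablePred (· ∈ G)]
    (hG : ∀ e, e ∉ touches ends U → e ∈ G) (h : Conn ends ω p q) :
    Conn ends (restrict G ω) p q := by
  refine mem_of_conn_of_closed (S := {u | Conn ends (restrict G ω) p u}) ?_ (conn_refl _ _ _) h
  intro u hu w huw
  obtain ⟨_, e, he, hends⟩ := openGraph_adj.1 huw
  have hpu : Conn ends ω p u := conn_mono (restrict_le G ω) hu
  have hpw : Conn ends ω p w := conn_trans hpu (conn_of_openAdj ⟨e, he, hends⟩)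
  have heG : e ∈ G := by
    refine hG e fun hmem => ?_
    obtain ⟨z, hz, z', hzz'⟩ := hmem
    rw [hends, Sym2.eq_iff] at hzz'
    rcases hzz' with ⟨rfl, _⟩ | ⟨_, rfl⟩
    · exact hU _ hz hpu
    · exact hU _ hz hpw
  have he' : restrict G ω e = true := restrict_eq_true_iff.2 ⟨he, heG⟩
  exact conn_trans hu (conn_of_openAdj ⟨e, he', hends⟩)

/-- The event «the BLUE cluster of `v` is exactly `fam v` for every `v ∈ S`». -/
def blueFamilyEvent (ends : E → Sym2 V) (S : Set V) (fam : V → Set V) : Set (Config E) :=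
  {ω | ∀ v ∈ S, cluster ends (flip ω) v = fam v}

/-- The union of the clusters of the family over `S`. -/
def famUnion (S : Set V) (fam : V → Set V) : Set V := ⋃ v ∈ S, fam v

/-- Edges touching one cluster of the family touch the union. -/
lemma touches_subset_touches_famUnion (ends : E → Sym2 V) (S : Set V) (fam : V → Set V)
    {v : V} (hv : v ∈ S) : touches ends (fam v) ⊆ touches ends (famUnion S fam) := by
  rintro e ⟨x, hx, y, hxy⟩
  exact ⟨x, Set.mem_iUnion₂.2 ⟨v, hv, hx⟩, y, hxy⟩

/-- The family event is determined by the edges touching the union of the family. -/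
lemma dependsOn_blueFamilyEvent (ends : E → Sym2 V) (S : Set V) (fam : V → Set V) :
    DependsOn (· ∈ blueFamilyEvent ends S fam) (touches ends (famUnion S fam)) := by
  intro ω ω' h
  have key : ∀ v ∈ S, cluster ends (flip ω) v = fam v ↔ cluster ends (flip ω') v = fam v := by
    intro v hv
    have h' : ∀ e ∈ touches ends (fam v), flip ω e = flip ω' e := fun e he => by
      simp only [flip_apply, h e (touches_subset_touches_famUnion ends S fam hv he)]
    exact ⟨cluster_eq_of_eqOn_touches h', cluster_eq_of_eqOn_touches fun e he => (h' e he).symm⟩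
  exact propext ⟨fun hω v hv => (key v hv).1 (hω v hv), fun hω v hv => (key v hv).2 (hω v hv)⟩

/-- On the family event, a vertex `p` outside every cluster of the family is blue-disconnected
from the whole union. -/
lemma not_conn_famUnion {ends : E → Sym2 V} {S : Set V} {fam : V → Set V} {p : V}
    {ω : Config E} (hK : ω ∈ blueFamilyEvent ends S fam) (hp : ∀ v ∈ S, p ∉ fam v) :
    ∀ z ∈ famUnion S fam, ¬ Conn ends (flip ω) p z := by
  intro z hz hpz
  obtain ⟨v, hv, hzv⟩ := Set.mem_iUnion₂.1 hz
  have hcl : cluster ends (flip ω) v = fam v := hK v hv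
  rw [← hcl] at hzv
  apply hp v hv
  rw [← hcl]
  exact conn_trans hzv (conn_symm hpz)

/-- The family event is invariant under the reflection of the outside edges. -/
lemma mem_blueFamilyEvent_flipOff {ends : E → Sym2 V} {S : Set V} {fam : V → Set V}
    [DecidablePred (· ∈ touches ends (famUnion S fam))] {ω : Config E}
    (hK : ω ∈ blueFamilyEvent ends S fam) :
    flipOff (touches ends (famUnion S fam)) ω ∈ blueFamilyEvent ends S fam := by
  intro v hv
  refine cluster_eq_of_eqOn_touches (ω := flip ω) ?_ (hK v hv)
  intro e he
  simp only [flip_apply,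
    flipOff_apply_of_mem _ _ (touches_subset_touches_famUnion ends S fam hv he)]

/-- On the family event with `p` outside the family: a blue `p`–`q` path reflected outside the
family is a red `p`–`q` path. -/
lemma redConn_of_blueConn_flipOff_family {ends : E → Sym2 V} {S : Set V} {fam : V → Set V}
    {p q : V} [DecidablePred (· ∈ touches ends (famUnion S fam))] {ω : Config E}
    (hK : ω ∈ blueFamilyEvent ends S fam) (hp : ∀ v ∈ S, p ∉ fam v)
    (h : Conn ends (flip ω) p q) : Conn ends (flipOff (touches ends (famUnion S fam)) ω) p q := by
  have h1 : Conn ends (restrict (touches ends (famUnion S fam))ᶜ (flip ω)) p q :=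
    conn_restrict_of_not_conn (not_conn_famUnion hK hp) _ (fun e he => he) h
  refine conn_mono ?_ h1
  intro e
  by_cases he : e ∈ touches ends (famUnion S fam)
  · rw [restrict_apply_of_notMem (show e ∉ (touches ends (famUnion S fam))ᶜ from fun h' => h' he)]
    exact Bool.false_le _
  · rw [restrict_apply_of_mem (show e ∈ (touches ends (famUnion S fam))ᶜ from he),
      flipOff_apply_of_notMem _ _ he]
    exact le_rfl

/-- On the family event with `p` outside the family: a blue `p`–`q` path of the outside-reflected
configuration is a red `p`–`q` path of the original one. -/
lemma redConn_of_flipOff_blueConn_family {ends : E → Sym2 V} {S : Set V} {fam : V → Set V}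
    {p q : V} [DecidablePred (· ∈ touches ends (famUnion S fam))] {ω : Config E}
    (hK : ω ∈ blueFamilyEvent ends S fam) (hp : ∀ v ∈ S, p ∉ fam v)
    (h : Conn ends (flip (flipOff (touches ends (famUnion S fam)) ω)) p q) : Conn ends ω p q := by
  have hK' := mem_blueFamilyEvent_flipOff hK
  have h1 : Conn ends (restrict (touches ends (famUnion S fam))ᶜ
      (flip (flipOff (touches ends (famUnion S fam)) ω))) p q :=
    conn_restrict_of_not_conn (not_conn_famUnion hK' hp) _ (fun e he => he) h
  refine conn_mono ?_ h1
  intro e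
  by_cases he : e ∈ touches ends (famUnion S fam)
  · rw [restrict_apply_of_notMem (show e ∉ (touches ends (famUnion S fam))ᶜ from fun h' => h' he)]
    exact Bool.false_le _
  · rw [restrict_apply_of_mem (show e ∈ (touches ends (famUnion S fam))ᶜ from he)]
    simp only [flip_apply, flipOff_apply_of_notMem _ _ he, Bool.not_not]
    exact le_rfl

variable [Fintype E] [DecidableEq E] {R : Type*} [CommRing R] [PartialOrder R]
  [IsStrictOrderedRing R]

/-- **RED-FAVOUR on an explored family of blue clusters.** For a family with `p ∉ fam v` for
every `v ∈ S` and any increasing event `I`: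
P(family, `p ~_b q`, `p ≁_r q`, `I`) ≤ P(family, `p ~_r q`, `p ≁_b q`, `I`). -/
theorem prob_blueFamily_blue_red_le_prob_blueFamily_red_blue (ends : E → Sym2 V) (p q : V)
    (S : Set V) (fam : V → Set V) {I : Set (Config E)} (hI : IsUpperSet I) {wt : E → R}
    (hwt : IsProbVec wt) (hhalf : ∀ e, 1 - wt e ≤ wt e) (hp : ∀ v ∈ S, p ∉ fam v) :
    prob wt (blueFamilyEvent ends S fam ∩ (blueConn ends p q ∩ (redConn ends p q)ᶜ) ∩ I) ≤
      prob wt (blueFamilyEvent ends S fam ∩ (redConn ends p q ∩ (blueConn ends p q)ᶜ) ∩ I) := by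
  classical
  have hA : IsLowerSet (blueConn ends p q ∩ (redConn ends p q)ᶜ) :=
    (isLowerSet_blueConn ends p q).inter (isUpperSet_redConn ends p q).compl
  have h1 := prob_inter_le_prob_flipOff_inter_of_dependsOn hwt (touches ends (famUnion S fam))
    (fun e _ => hhalf e) (dependsOn_blueFamilyEvent ends S fam) hA hI
  refine h1.trans (prob_mono hwt ?_)
  rintro ω ⟨⟨hK, hflip⟩, hW⟩
  refine ⟨⟨hK, ?_, ?_⟩, hW⟩
  · exact redConn_of_flipOff_blueConn_family hK hp hflip.1
  · intro hb
    exact hflip.2 (redConn_of_blueConn_flipOff_family hK hp hb)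

end Family

section Summed

variable {V : Type*} {E : Type*} [Fintype V] [DecidableEq V] [Fintype E] [DecidableEq E]
  {R : Type*} [CommRing R] [PartialOrder R] [IsStrictOrderedRing R]

/-- The family of blue clusters of the vertices of `S` (and `∅` off `S`). -/
def famOf (ends : E → Sym2 V) (S : Finset V) (ω : Config E) : V → Set V :=
  fun v => if v ∈ S then cluster ends (flip ω) v else ∅

/-- No vertex of `S` is blue-joined to `p` or to `q` (`S ∩ C = ∅`). -/
def notBlueJoinedAll (ends : E → Sym2 V) (p q : V) (S : Finset V) : Set (Config E) :=
  {ω | ∀ v ∈ S, ¬ Conn ends (flip ω) p v ∧ ¬ Conn ends (flip ω) q v}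

omit [PartialOrder R] [IsStrictOrderedRing R] in
/-- The events «`famOf ω = fam`» partition the configurations. -/
lemma prob_eq_sum_famOf (ends : E → Sym2 V) (S : Finset V) (wt : E → R) (B : Set (Config E)) :
    prob wt B = ∑ fam : V → Set V, prob wt ({ω | famOf ends S ω = fam} ∩ B) := by
  classical
  unfold prob
  rw [Finset.sum_comm]
  refine Finset.sum_congr rfl fun ω _ => ?_
  rw [Finset.sum_eq_single (famOf ends S ω)]
  · by_cases hB : ω ∈ B
    · rw [Set.indicator_of_mem hB, Set.indicator_of_mem (show ω ∈ {ω' | famOf ends S ω' =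
        famOf ends S ω} ∩ B from ⟨rfl, hB⟩)]
    · rw [Set.indicator_of_notMem hB, Set.indicator_of_notMem (fun h => hB h.2)]
  · intro fam _ hfam
    exact Set.indicator_of_notMem (fun h => hfam h.1.symm) _
  · intro h
    exact absurd (Finset.mem_univ _) h

omit [Fintype V] [Fintype E] [DecidableEq E] in
/-- When `fam` vanishes off `S`, the class `famOf = fam` is the family event. -/
lemma famOf_eq_iff (ends : E → Sym2 V) (S : Finset V) (fam : V → Set V)
    (hoff : ∀ v, v ∉ S → fam v = ∅) (ω : Config E) :
    famOf ends S ω = fam ↔ ω ∈ blueFamilyEvent ends (↑S) fam := by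
  constructor
  · intro h v hv
    have := congrFun h v
    unfold famOf at this
    rw [if_pos (Finset.mem_coe.1 hv)] at this
    exact this
  · intro h
    funext v
    unfold famOf
    by_cases hv : v ∈ S
    · rw [if_pos hv]; exact h v (Finset.mem_coe.2 hv)
    · rw [if_neg hv]; exact (hoff v hv).symm

/-- **RED-FAVOUR, summed over the families: the all-red-only slice for any `S`.** For any
predicate `Φ` on the family of blue clusters of the vertices of `S`, with `S` blue-disjoint from
`p, q` and any increasing event `I`:
P(Φ, `S ∩ C = ∅`, `p ~_b q`, `p ≁_r q`, `I`) ≤ P(Φ, `S ∩ C = ∅`, `p ~_r q`, `p ≁_b q`, `I`). -/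
theorem prob_family_blue_red_le_prob_family_red_blue (ends : E → Sym2 V) (p q : V)
    (S : Finset V) (Φ : (V → Set V) → Prop) {I : Set (Config E)} (hI : IsUpperSet I)
    {wt : E → R} (hwt : IsProbVec wt) (hhalf : ∀ e, 1 - wt e ≤ wt e) :
    prob wt ({ω | Φ (famOf ends S ω)} ∩ notBlueJoinedAll ends p q S ∩
        (blueConn ends p q ∩ (redConn ends p q)ᶜ) ∩ I) ≤
      prob wt ({ω | Φ (famOf ends S ω)} ∩ notBlueJoinedAll ends p q S ∩
        (redConn ends p q ∩ (blueConn ends p q)ᶜ) ∩ I) := by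
  classical
  rw [prob_eq_sum_famOf ends S, prob_eq_sum_famOf ends S]
  refine Finset.sum_le_sum fun fam _ => ?_
  have h0 : prob wt (∅ : Set (Config E)) = 0 := by simp [prob]
  by_cases hgood : (∀ v, v ∉ S → fam v = ∅) ∧ (∀ v ∈ S, p ∉ fam v ∧ q ∉ fam v) ∧ Φ fam
  · obtain ⟨hoff, hpq, hΦ⟩ := hgood
    have hp : ∀ v ∈ (↑S : Set V), p ∉ fam v := fun v hv => (hpq v hv).1
    -- on the class, the predicate and the blue-disjointness are automatic
    have eL : {ω | famOf ends S ω = fam} ∩ ({ω | Φ (famOf ends S ω)} ∩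
        notBlueJoinedAll ends p q S ∩ (blueConn ends p q ∩ (redConn ends p q)ᶜ) ∩ I) =
        blueFamilyEvent ends (↑S) fam ∩ (blueConn ends p q ∩ (redConn ends p q)ᶜ) ∩ I := by
      ext ω
      constructor
      · rintro ⟨hf, ⟨⟨_, _⟩, hA⟩, hI'⟩
        exact ⟨⟨(famOf_eq_iff ends S fam hoff ω).1 hf, hA⟩, hI'⟩
      · rintro ⟨⟨hK, hA⟩, hI'⟩
        have hf : famOf ends S ω = fam := (famOf_eq_iff ends S fam hoff ω).2 hK
        refine ⟨hf, ⟨⟨show Φ (famOf ends S ω) by rw [hf]; exact hΦ, ?_⟩, hA⟩, hI'⟩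
        intro v hv
        have hcl : cluster ends (flip ω) v = fam v := hK v hv
        constructor
        · intro hc; exact (hpq v hv).1 (hcl ▸ (conn_symm hc : Conn ends (flip ω) v p))
        · intro hc; exact (hpq v hv).2 (hcl ▸ (conn_symm hc : Conn ends (flip ω) v q))
    have eR : {ω | famOf ends S ω = fam} ∩ ({ω | Φ (famOf ends S ω)} ∩
        notBlueJoinedAll ends p q S ∩ (redConn ends p q ∩ (blueConn ends p q)ᶜ) ∩ I) =
        blueFamilyEvent ends (↑S) fam ∩ (redConn ends p q ∩ (blueConn ends p q)ᶜ) ∩ I := by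
      ext ω
      constructor
      · rintro ⟨hf, ⟨⟨_, _⟩, hA⟩, hI'⟩
        exact ⟨⟨(famOf_eq_iff ends S fam hoff ω).1 hf, hA⟩, hI'⟩
      · rintro ⟨⟨hK, hA⟩, hI'⟩
        have hf : famOf ends S ω = fam := (famOf_eq_iff ends S fam hoff ω).2 hK
        refine ⟨hf, ⟨⟨show Φ (famOf ends S ω) by rw [hf]; exact hΦ, ?_⟩, hA⟩, hI'⟩
        intro v hv
        have hcl : cluster ends (flip ω) v = fam v := hK v hv
        constructor
        · intro hc; exact (hpq v hv).1 (hcl ▸ (conn_symm hc : Conn ends (flip ω) v p))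
        · intro hc; exact (hpq v hv).2 (hcl ▸ (conn_symm hc : Conn ends (flip ω) v q))
    rw [eL, eR]
    exact prob_blueFamily_blue_red_le_prob_blueFamily_red_blue ends p q (↑S) fam hI hwt hhalf hp
  · -- the left-hand class is empty
    have eL : {ω | famOf ends S ω = fam} ∩ ({ω | Φ (famOf ends S ω)} ∩
        notBlueJoinedAll ends p q S ∩ (blueConn ends p q ∩ (redConn ends p q)ᶜ) ∩ I) = ∅ := by
      ext ω
      refine ⟨?_, fun h => h.elim⟩
      rintro ⟨hf, ⟨⟨hΦ, hNB⟩, _⟩, _⟩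
      apply hgood
      have hΦ' : Φ (famOf ends S ω) := hΦ
      refine ⟨fun v hv => ?_, fun v hv => ?_, by rw [← hf]; exact hΦ'⟩
      · have := congrFun hf v
        unfold famOf at this
        rw [if_neg hv] at this
        exact this.symm
      · have hcl : cluster ends (flip ω) v = fam v := by
          have := congrFun hf v
          unfold famOf at this
          rw [if_pos hv] at this
          exact this
        rw [← hcl]
        exact ⟨fun hc => (hNB v hv).1 (conn_symm hc), fun hc => (hNB v hv).2 (conn_symm hc)⟩
    rw [eL, h0]
    exact prob_nonneg hwt _

end Summed

end RedFavour

end Summit.Ventures.PercRepro2
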